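import Mathlib
import Literature.NumberTheory.Transcendental.KZCubeRationalMoves
import Literature.NumberTheory.Transcendental.KZFibreMapMove
import Literature.NumberTheory.Transcendental.KZSemiCanonicalReductionProofs
import Summits.KontsevichZagierPeriods.KontsevichZagierPeriods.Theorems.SoloBlindZetaTwoCharts
import Summits.KontsevichZagierPeriods.KontsevichZagierPeriods.Theorems.SoloBlindEta
import HarnessLib
import Literature.NumberTheory.Transcendental.KZCalculus

/-!
# Log-fibre calculus for `RationalCubePiKernelSingle` (route `RootDecompRationalCubeDichotomy`, crux stmt-KontsevichZagierPeriods-26322) at `m = 2` · part 1/4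

Cell `decomp-kz`, lens 2 (decomp-kz-lens-2 g6): the LOG-FIBRE SECTOR `Λ[E] = [[0,1]², E(y)/(1 + x·y·E(y))]`
(`E ∈ ℚ(y)` regular, `≥ 0`) is closed under the moves by RULE (2) ONLY — product rule `lam_mul`
(`Λ[E₁+E₂+yE₁E₂] ≡ Λ[E₁] + Λ[E₂]`, a fibred chart) and power rule `lam_pow`; inside it the whole `π²`-class of the
cell's weight-2 census (`census₂ … census₆`, 15/15 pairs) and the route's `EulerInstance`
(`euler_rel : 3•[□,1/(1+xy)] − 4•[□,1/((1+x²)(1+y²))] ∈ KZ.relations`) are DECIDED with `N = 0`, and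
`single_inst₂ … single_inst₆`, `single_instEuler` are the corresponding LITERAL instances of the binder list of
`RationalCubePiKernelSingle` at `m = 2` (the route decl is not referenced by name, so these modules do not import
the route file).

Source: `HOME/decomp-kz-lens-2/g6/LogFibreCalculus.lean` sha256 73bd8b5e80afc467 (1113 l; critic decomp-kz-crit-1 g2 CLEARED
2026-08-30T08:00:40Z incl. the binder check, std axioms), split into 4 modules by the landing seat decomp-kz-census-1 g7
(contexts re-opened per part; generic docstrings added where the source had none).  No `sorry`; standard axioms.
References: [cite: KontsevichZagier2001, §1.2].
-/

noncomputable section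
open Set MeasureTheory MvPolynomial
open Literature.ModelTheory.ExponentialFields (IsSemialgebraic)
open Literature.NumberTheory.Transcendental
open Literature.NumberTheory.Transcendental.KZ
open Literature.NumberTheory.Transcendental.KZ.RFun
open Summit.KontsevichZagierPeriods.KontsevichZagierPeriods.Theorems

namespace Summit.KontsevichZagierPeriods.RootDecompRationalCubeDichotomy.LogFibre

/-! ## 0. The fibred change of variables for regular rational functions on the cube -/

/-- `[0,1]^{M+1}` is the band over `[0,1]^M` with edges `0` and `1`. -/
theorem cube_succ_eq_band (M : ℕ) :
    KZ.cube (M + 1) = KZlog.band (KZ.cube M) (fun _ => (0 : ℝ)) (fun _ => 1) := by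
  rw [KZ.cube_succ_eq]; rfl

/-- **Fibred substitution for regular rational functions.**  If `U : [0,1]^{M+1} → ℝ` is a regular
rational function with `∂U/∂s = ψs > 0` along the last coordinate `s`, `U(x,0) = 0`, `U(x,1) = 1`,
and `T(x,s) = S(x, U(x,s)) · ψs(x,s)` on the cube, then `[T] ≡ [S]` — the landed move
`KZ.of_sub_of_mem_relations_of_fibreMap` with every tameness hypothesis discharged. -/
theorem rel_fibreMap {M : ℕ} (T S U : RFun (M + 1)) (ψs : (Fin (M + 1) → ℝ) → ℝ)
    (hderiv : ∀ z ∈ KZ.cube (M + 1),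
      HasDerivAt (fun s : ℝ => U.fn (Fin.snoc (Fin.init z) s)) (ψs z) (z (Fin.last M)))
    (hpos : ∀ z ∈ KZ.cube (M + 1), 0 < ψs z)
    (h0 : ∀ x ∈ KZ.cube M, U.fn (Fin.snoc x 0) = 0)
    (h1 : ∀ x ∈ KZ.cube M, U.fn (Fin.snoc x 1) = 1)
    (hint : ∀ z ∈ KZ.cube (M + 1), T.fn z = S.fn (Fin.snoc (Fin.init z) (U.fn z)) * ψs z) :
    KZ.of T.rep - KZ.of S.rep ∈ KZ.relations :=
  KZ.of_sub_of_mem_relations_of_fibreMap (G := KZ.cube M) (a := fun _ => (0 : ℝ))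
    (b := fun _ => (1 : ℝ)) (a' := fun _ => (0 : ℝ)) (b' := fun _ => (1 : ℝ)) U.fn ψs T.rep S.rep
    (cube_succ_eq_band M) (cube_succ_eq_band M) (fun _ _ => zero_le_one)
    U.isSemialgebraicFunOn_fn (fun z hz => (U.analyticOnNhd_fn z hz).differentiableAt)
    hderiv hpos h0 h1 hint

/-! ## 1. Coordinates on `[0,1]²` and one-variable regular rational functions -/

/-- `mem_cube_two`: auxiliary theorem of the log-fibre calculus for `RationalCubePiKernelSingle` (stmt-26322) — see the module docstring; verbatim from the lens-2 g6 file. -/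
theorem mem_cube_two {z : Fin 2 → ℝ} (hz : z ∈ KZ.cube 2) :
    (0 ≤ z 0 ∧ z 0 ≤ 1) ∧ (0 ≤ z 1 ∧ z 1 ≤ 1) := ⟨hz 0, hz 1⟩

/-- `init_mem_cube_one`: auxiliary theorem of the log-fibre calculus for `RationalCubePiKernelSingle` (stmt-26322) — see the module docstring; verbatim from the lens-2 g6 file. -/
theorem init_mem_cube_one {z : Fin 2 → ℝ} (hz : z ∈ KZ.cube 2) : Fin.init z ∈ KZ.cube 1 :=
  fun i => hz (Fin.castSucc i)

/-- `mem_cube_one_iff`: auxiliary theorem of the log-fibre calculus for `RationalCubePiKernelSingle` (stmt-26322) — see the module docstring; verbatim from the lens-2 g6 file. -/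
theorem mem_cube_one_iff {y : Fin 1 → ℝ} : y ∈ KZ.cube 1 ↔ 0 ≤ y 0 ∧ y 0 ≤ 1 := by
  rw [KZ.mem_cube]
  exact ⟨fun h => h 0, fun h i => by fin_cases i; exact h⟩

/-- `snoc_two_zero` (PRIVATE copy: landed twin `Summit.KontsevichZagierPeriods.HermiteRigidity.EllipticMomentKernelNegative.snoc₂_apply_zero` lives in a farm-unbuilt module): auxiliary theorem of the log-fibre calculus for `RationalCubePiKernelSingle` (stmt-26322) — see the module docstring; verbatim from the lens-2 g6 file. -/
@[simp] private theorem snoc_two_zero (y : Fin 1 → ℝ) (s : ℝ) : (Fin.snoc y s : Fin 2 → ℝ) 0 = y 0 := rfl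

/-- `snoc_two_one` (PRIVATE copy: landed twin `…EllipticMomentKernelNegative.snoc₂_apply_one` lives in a farm-unbuilt module): auxiliary theorem of the log-fibre calculus for `RationalCubePiKernelSingle` (stmt-26322) — see the module docstring; verbatim from the lens-2 g6 file. -/
@[simp] private theorem snoc_two_one (y : Fin 1 → ℝ) (s : ℝ) : (Fin.snoc y s : Fin 2 → ℝ) 1 = s := rfl

/-- `init_apply_zero` (PRIVATE copy: landed twin `…BetaCancellationLine.intOut_init_zero` lives in a farm-unbuilt module): auxiliary theorem of the log-fibre calculus for `RationalCubePiKernelSingle` (stmt-26322) — see the module docstring; verbatim from the lens-2 g6 file. -/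
@[simp] private theorem init_apply_zero (z : Fin 2 → ℝ) : Fin.init z 0 = z 0 := rfl

/-- The one-variable function `t ↦ E(t)` of `E : RFun 1`. -/
def ev (E : RFun 1) (t : ℝ) : ℝ := E.fn (fun _ => t)

/-- `fn_eq_ev`: auxiliary theorem of the log-fibre calculus for `RationalCubePiKernelSingle` (stmt-26322) — see the module docstring; verbatim from the lens-2 g6 file. -/
theorem fn_eq_ev (E : RFun 1) (y : Fin 1 → ℝ) : E.fn y = ev E (y 0) := by
  unfold ev; congr 1; funext i; fin_cases i; rfl

/-- `fn_lift_eq_ev`: auxiliary theorem of the log-fibre calculus for `RationalCubePiKernelSingle` (stmt-26322) — see the module docstring; verbatim from the lens-2 g6 file. -/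
theorem fn_lift_eq_ev (E : RFun 1) (z : Fin 2 → ℝ) : E.lift.fn z = ev E (z 0) := by
  rw [fn_lift, fn_eq_ev]; rfl

/-- `aeval` at a `snoc` point of a polynomial in the first variables. -/
theorem aeval_snoc_rename {M : ℕ} (P : MvPolynomial (Fin M) ℚ) (x : Fin M → ℝ) (s : ℝ) :
    aeval (Fin.snoc x s : Fin (M + 1) → ℝ) (MvPolynomial.rename Fin.castSucc P) = aeval x P := by
  have h : ((Fin.snoc x s : Fin (M + 1) → ℝ) ∘ Fin.castSucc) = x := by
    funext i
    simp [Function.comp]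
  rw [aeval_rename, h]

/-- Nonnegativity on `[0,1]` (hypothesis `∀ t ∈ Icc 0 1, 0 ≤ ev E t`) at cube points. -/
theorem fn_nonneg_of {E : RFun 1} (hE : ∀ t ∈ Icc (0 : ℝ) 1, 0 ≤ ev E t) {y : Fin 1 → ℝ}
    (hy : y ∈ KZ.cube 1) : 0 ≤ E.fn y := by
  rw [fn_eq_ev]; exact hE _ (mem_cube_one_iff.mp hy)

/-! ## 2. The log-fibre representations `Λ[E] = [[0,1]², E(y)/(1 + x y E(y))]` -/

/-- `lam_den_ne`: auxiliary theorem of the log-fibre calculus for `RationalCubePiKernelSingle` (stmt-26322) — see the module docstring; verbatim from the lens-2 g6 file. -/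
theorem lam_den_ne (E : RFun 1) (hE : ∀ t ∈ Icc (0 : ℝ) 1, 0 ≤ ev E t) (z : Fin 2 → ℝ) (hz : z ∈ KZ.cube 2) :
    aeval z (E.lift.den + X 1 * X 0 * E.lift.num) ≠ 0 := by
  have hD : aeval z E.lift.den ≠ 0 := E.lift.den_ne z hz
  have hEz : 0 ≤ aeval z E.lift.num / aeval z E.lift.den := by
    have := fn_nonneg_of hE (init_mem_cube_one hz)
    rwa [← fn_lift, fn_apply] at this
  have h01 := mem_cube_two hz
  have hprod : 0 ≤ z 1 * z 0 * (aeval z E.lift.num / aeval z E.lift.den) :=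
    mul_nonneg (mul_nonneg h01.2.1 h01.1.1) hEz
  intro h
  have key : aeval z E.lift.den * (1 + z 1 * z 0 * (aeval z E.lift.num / aeval z E.lift.den)) = 0 := by
    rw [mul_add, mul_one, ← h]
    simp only [map_add, map_mul, aeval_X]
    field_simp
  rcases mul_eq_zero.mp key with h' | h'
  · exact hD h'
  · linarith

/-- **`Λ[E]`** (`y = z 0` the parameter, `x = z 1` the homotopy/fibre variable). -/
def lam (E : RFun 1) (hE : ∀ t ∈ Icc (0 : ℝ) 1, 0 ≤ ev E t) : RFun 2 :=
  ⟨E.lift.num, E.lift.den + X 1 * X 0 * E.lift.num, lam_den_ne E hE⟩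

/-- The function of `Λ[E]` on the square. -/
theorem fn_lam {E : RFun 1} {hE : ∀ t ∈ Icc (0 : ℝ) 1, 0 ≤ ev E t} {z : Fin 2 → ℝ} (hz : z ∈ KZ.cube 2) :
    (lam E hE).fn z = ev E (z 0) / (1 + z 1 * z 0 * ev E (z 0)) := by
  have hD : aeval z E.lift.den ≠ 0 := E.lift.den_ne z hz
  have hne := lam_den_ne E hE z hz
  simp only [map_add, map_mul, aeval_X] at hne
  have hEv : ev E (z 0) = aeval z E.lift.num / aeval z E.lift.den := by
    rw [← fn_lift_eq_ev, fn_apply]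
  rw [hEv, fn_apply]
  show aeval z E.lift.num / aeval z (E.lift.den + X 1 * X 0 * E.lift.num) = _
  simp only [map_add, map_mul, aeval_X]
  field_simp

/-- `1 + x y E(y) > 0` on the square. -/
theorem one_add_pos {E : RFun 1} (hE : ∀ t ∈ Icc (0 : ℝ) 1, 0 ≤ ev E t) {z : Fin 2 → ℝ} (hz : z ∈ KZ.cube 2) :
    0 < 1 + z 1 * z 0 * ev E (z 0) := by
  have h01 := mem_cube_two hz
  have : 0 ≤ z 1 * z 0 * ev E (z 0) := mul_nonneg (mul_nonneg h01.2.1 h01.1.1) (hE _ h01.1)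
  linarith

/-- Natural-number multiples: `[c·T] ≡ c • [T]`. -/
theorem rel_constMul (c : ℕ) (T : RFun 2) :
    KZ.of (((const (c : ℚ)).mul T)).rep - c • KZ.of T.rep ∈ KZ.relations :=
  SoloBlind.of_sub_nsmul_mem_relations c rfl fun x _ => by
    simp only [rep_integrand, fn_mul, fn_const, Rat.cast_natCast]

/-! ## 3. The product rule `Λ[E₁ + E₂ + y E₁ E₂] ≡ Λ[E₁] + Λ[E₂]` -/

/-- Clearing the one-variable denominators in `A + c·B` (`A = e₁ + e₂`, `B = e₁ e₂`). -/
theorem clear_aux {N₁ D₁ N₂ D₂ : ℝ} (c : ℝ) (hD₁ : D₁ ≠ 0) (hD₂ : D₂ ≠ 0) :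
    N₁ * D₂ + N₂ * D₁ + c * (N₁ * N₂) =
      D₁ * D₂ * (N₁ / D₁ + N₂ / D₂ + c * (N₁ / D₁) * (N₂ / D₂)) := by
  field_simp

/-- `aeval_lift_num`: auxiliary theorem of the log-fibre calculus for `RationalCubePiKernelSingle` (stmt-26322) — see the module docstring; verbatim from the lens-2 g6 file. -/
theorem aeval_lift_num (E : RFun 1) (z : Fin 2 → ℝ) :
    aeval z E.lift.num = aeval (Fin.init z) E.num := by
  show aeval z (MvPolynomial.rename Fin.castSucc E.num) = _
  rw [aeval_rename]; rfl

/-- `aeval_lift_den`: auxiliary theorem of the log-fibre calculus for `RationalCubePiKernelSingle` (stmt-26322) — see the module docstring; verbatim from the lens-2 g6 file. -/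
theorem aeval_lift_den (E : RFun 1) (z : Fin 2 → ℝ) :
    aeval z E.lift.den = aeval (Fin.init z) E.den := by
  show aeval z (MvPolynomial.rename Fin.castSucc E.den) = _
  rw [aeval_rename]; rfl

/-- `ev_eq_div`: auxiliary theorem of the log-fibre calculus for `RationalCubePiKernelSingle` (stmt-26322) — see the module docstring; verbatim from the lens-2 g6 file. -/
theorem ev_eq_div (E : RFun 1) (y : Fin 1 → ℝ) :
    ev E (y 0) = aeval y E.num / aeval y E.den := by
  rw [← fn_apply, fn_eq_ev]

/-- The pure algebra of the product rule: `Λ₁ + Λ₂ = (Λ ∘ chart) · ∂(chart)`. -/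
theorem mul_identity {e₁ e₂ x y : ℝ} (he₁ : 0 ≤ e₁) (he₂ : 0 ≤ e₂) (hs : 0 < e₁ + e₂)
    (hx : 0 ≤ x) (hy : 0 ≤ y) :
    e₁ / (1 + x * y * e₁) + e₂ / (1 + x * y * e₂) =
      (e₁ + e₂ + y * e₁ * e₂) /
          (1 + x * (e₁ + e₂ + x * y * e₁ * e₂) / (e₁ + e₂ + y * e₁ * e₂) * y *
              (e₁ + e₂ + y * e₁ * e₂)) *
        ((e₁ + e₂ + 2 * x * y * e₁ * e₂) / (e₁ + e₂ + y * e₁ * e₂)) := by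
  have h1 : 0 < 1 + x * y * e₁ := by
    have := mul_nonneg (mul_nonneg hx hy) he₁; linarith
  have h2 : 0 < 1 + x * y * e₂ := by
    have := mul_nonneg (mul_nonneg hx hy) he₂; linarith
  have hS : 0 < e₁ + e₂ + y * e₁ * e₂ := by
    have := mul_nonneg (mul_nonneg hy he₁) he₂; linarith
  have hP : 0 < 1 + x * (e₁ + e₂ + x * y * e₁ * e₂) * y := by
    have := mul_nonneg (mul_nonneg (mul_nonneg hx hy) he₁) he₂
    have := mul_nonneg (mul_nonneg hx (by linarith : 0 ≤ e₁ + e₂ + x * y * e₁ * e₂)) hy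
    linarith
  have hS' := hS.ne'
  have hclear : 1 + x * (e₁ + e₂ + x * y * e₁ * e₂) / (e₁ + e₂ + y * e₁ * e₂) * y *
      (e₁ + e₂ + y * e₁ * e₂) = 1 + x * (e₁ + e₂ + x * y * e₁ * e₂) * y := by
    rw [div_mul_eq_mul_div, div_mul_eq_mul_div, mul_div_cancel_right₀ _ hS']
  rw [hclear, div_add_div _ _ h1.ne' h2.ne', div_mul_div_comm,
    div_eq_div_iff (mul_ne_zero h1.ne' h2.ne') (mul_ne_zero hP.ne' hS')]
  ring

section Mul

variable {E₁ E₂ : RFun 1} (h₁ : ∀ t ∈ Icc (0 : ℝ) 1, 0 ≤ ev E₁ t)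
  (h₂ : ∀ t ∈ Icc (0 : ℝ) 1, 0 ≤ ev E₂ t) (hsum : ∀ t ∈ Icc (0 : ℝ) 1, 0 < ev E₁ t + ev E₂ t)

/-- Values at a point `y ∈ [0,1]`: denominators `≠ 0`, `e₁, e₂ ≥ 0`, `e₁ + e₂ > 0`. -/
theorem facts_one (h₁ : ∀ t ∈ Icc (0 : ℝ) 1, 0 ≤ ev E₁ t) (h₂ : ∀ t ∈ Icc (0 : ℝ) 1, 0 ≤ ev E₂ t)
    (hsum : ∀ t ∈ Icc (0 : ℝ) 1, 0 < ev E₁ t + ev E₂ t) {y : Fin 1 → ℝ} (hy : y ∈ KZ.cube 1) :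
    aeval y E₁.den ≠ 0 ∧ aeval y E₂.den ≠ 0 ∧ 0 ≤ ev E₁ (y 0) ∧ 0 ≤ ev E₂ (y 0) ∧
      0 < ev E₁ (y 0) + ev E₂ (y 0) ∧ 0 ≤ y 0 ∧ y 0 ≤ 1 :=
  ⟨E₁.den_ne _ hy, E₂.den_ne _ hy, h₁ _ (mem_cube_one_iff.mp hy), h₂ _ (mem_cube_one_iff.mp hy),
    hsum _ (mem_cube_one_iff.mp hy), (mem_cube_one_iff.mp hy).1, (mem_cube_one_iff.mp hy).2⟩

/-- `N₁D₂ + N₂D₁ + c N₁N₂ ≠ 0` on `[0,1]` for `c ≥ 0`. -/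
theorem alpha_ne (h₁ : ∀ t ∈ Icc (0 : ℝ) 1, 0 ≤ ev E₁ t) (h₂ : ∀ t ∈ Icc (0 : ℝ) 1, 0 ≤ ev E₂ t)
    (hsum : ∀ t ∈ Icc (0 : ℝ) 1, 0 < ev E₁ t + ev E₂ t) {y : Fin 1 → ℝ} (hy : y ∈ KZ.cube 1)
    {c : ℝ} (hc : 0 ≤ c) :
    aeval y E₁.num * aeval y E₂.den + aeval y E₂.num * aeval y E₁.den +
        c * (aeval y E₁.num * aeval y E₂.num) ≠ 0 := by
  obtain ⟨hD₁, hD₂, he₁, he₂, hs, -, -⟩ := facts_one h₁ h₂ hsum hy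
  rw [clear_aux c hD₁ hD₂, ← ev_eq_div, ← ev_eq_div]
  refine mul_ne_zero (mul_ne_zero hD₁ hD₂) (ne_of_gt ?_)
  have : 0 ≤ c * ev E₁ (y 0) * ev E₂ (y 0) := mul_nonneg (mul_nonneg hc he₁) he₂
  linarith

/-- **The chart** `U(y,x) = x (A + x y B)/(A + y B)` (`A = E₁ + E₂`, `B = E₁E₂`), as a regular
rational function on the square (denominators of `E₁, E₂` cleared). -/
def mulChart (h₁ : ∀ t ∈ Icc (0 : ℝ) 1, 0 ≤ ev E₁ t) (h₂ : ∀ t ∈ Icc (0 : ℝ) 1, 0 ≤ ev E₂ t)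
    (hsum : ∀ t ∈ Icc (0 : ℝ) 1, 0 < ev E₁ t + ev E₂ t) : RFun 2 :=
  ⟨X 1 * ((E₁.lift.num * E₂.lift.den + E₂.lift.num * E₁.lift.den) +
      X 1 * X 0 * (E₁.lift.num * E₂.lift.num)),
    (E₁.lift.num * E₂.lift.den + E₂.lift.num * E₁.lift.den) + X 0 * (E₁.lift.num * E₂.lift.num),
    fun z hz => by
      simp only [map_add, map_mul, aeval_X, aeval_lift_num, aeval_lift_den]
      exact alpha_ne h₁ h₂ hsum (init_mem_cube_one hz) (mem_cube_two hz).1.1⟩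

/-- The chart on a fibre `{y} × ℝ` (ALL real `s`: needed for the derivative at the end-points). -/
theorem mulChart_fn_snoc {y : Fin 1 → ℝ} (hy : y ∈ KZ.cube 1) (s : ℝ) :
    (mulChart h₁ h₂ hsum).fn (Fin.snoc y s) =
      s * (ev E₁ (y 0) + ev E₂ (y 0) + s * y 0 * ev E₁ (y 0) * ev E₂ (y 0)) /
        (ev E₁ (y 0) + ev E₂ (y 0) + y 0 * ev E₁ (y 0) * ev E₂ (y 0)) := by
  obtain ⟨hD₁, hD₂, he₁, he₂, hs, hy0, -⟩ := facts_one h₁ h₂ hsum hy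
  have hR : ev E₁ (y 0) + ev E₂ (y 0) + y 0 * ev E₁ (y 0) * ev E₂ (y 0) ≠ 0 := by
    have : 0 ≤ y 0 * ev E₁ (y 0) * ev E₂ (y 0) := mul_nonneg (mul_nonneg hy0 he₁) he₂
    linarith
  have hL := alpha_ne h₁ h₂ hsum hy hy0
  rw [fn_apply]
  simp only [mulChart, map_add, map_mul, aeval_X, aeval_lift_num, aeval_lift_den, Fin.init_snoc,
    snoc_two_zero, snoc_two_one]
  rw [div_eq_div_iff hL hR, ev_eq_div E₁ y, ev_eq_div E₂ y]
  field_simp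

/-- The chart on the square. -/
theorem mulChart_fn {z : Fin 2 → ℝ} (hz : z ∈ KZ.cube 2) :
    (mulChart h₁ h₂ hsum).fn z =
      z 1 * (ev E₁ (z 0) + ev E₂ (z 0) + z 1 * z 0 * ev E₁ (z 0) * ev E₂ (z 0)) /
        (ev E₁ (z 0) + ev E₂ (z 0) + z 0 * ev E₁ (z 0) * ev E₂ (z 0)) := by
  have h := mulChart_fn_snoc h₁ h₂ hsum (init_mem_cube_one hz) (z (Fin.last 1))
  rw [Fin.snoc_init_self] at h
  exact h

/-- The chart maps the square into `[0,1]` fibrewise. -/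
theorem mulChart_mem {z : Fin 2 → ℝ} (hz : z ∈ KZ.cube 2) :
    0 ≤ (mulChart h₁ h₂ hsum).fn z ∧ (mulChart h₁ h₂ hsum).fn z ≤ 1 := by
  obtain ⟨-, -, he₁, he₂, hs, hy0, hy1⟩ := facts_one h₁ h₂ hsum (init_mem_cube_one hz)
  simp only [init_apply_zero] at he₁ he₂ hs hy0 hy1
  obtain ⟨-, hx0, hx1⟩ := mem_cube_two hz
  have hB : 0 ≤ ev E₁ (z 0) * ev E₂ (z 0) := mul_nonneg he₁ he₂
  have hS : 0 < ev E₁ (z 0) + ev E₂ (z 0) + z 0 * ev E₁ (z 0) * ev E₂ (z 0) := by nlinarith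
  rw [mulChart_fn h₁ h₂ hsum hz]
  refine ⟨div_nonneg (mul_nonneg hx0 (by nlinarith)) hS.le, (div_le_one hS).mpr ?_⟩
  have h1 : z 1 * (ev E₁ (z 0) + ev E₂ (z 0)) ≤ ev E₁ (z 0) + ev E₂ (z 0) := by nlinarith
  have h2 : z 1 * (z 1 * z 0 * ev E₁ (z 0) * ev E₂ (z 0)) ≤ z 0 * ev E₁ (z 0) * ev E₂ (z 0) := by
    have : z 1 * z 1 ≤ 1 := by nlinarith
    have h' : 0 ≤ z 0 * ev E₁ (z 0) * ev E₂ (z 0) := by nlinarith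
    nlinarith
  nlinarith

/-- The fibre derivative of the chart: `ψs = (A + 2 x y B)/(A + y B)`. -/
def mulDeriv (E₁ E₂ : RFun 1) (z : Fin 2 → ℝ) : ℝ :=
  (ev E₁ (z 0) + ev E₂ (z 0) + 2 * z 1 * z 0 * ev E₁ (z 0) * ev E₂ (z 0)) /
    (ev E₁ (z 0) + ev E₂ (z 0) + z 0 * ev E₁ (z 0) * ev E₂ (z 0))

/-- `mulDeriv_pos`: auxiliary theorem of the log-fibre calculus for `RationalCubePiKernelSingle` (stmt-26322) — see the module docstring; verbatim from the lens-2 g6 file. -/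
theorem mulDeriv_pos (h₁ : ∀ t ∈ Icc (0 : ℝ) 1, 0 ≤ ev E₁ t) (h₂ : ∀ t ∈ Icc (0 : ℝ) 1, 0 ≤ ev E₂ t)
    (hsum : ∀ t ∈ Icc (0 : ℝ) 1, 0 < ev E₁ t + ev E₂ t) {z : Fin 2 → ℝ} (hz : z ∈ KZ.cube 2) :
    0 < mulDeriv E₁ E₂ z := by
  obtain ⟨-, -, he₁, he₂, hs, hy0, -⟩ := facts_one h₁ h₂ hsum (init_mem_cube_one hz)
  simp only [init_apply_zero] at he₁ he₂ hs hy0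
  obtain ⟨-, hx0, -⟩ := mem_cube_two hz
  have hB : 0 ≤ z 0 * ev E₁ (z 0) * ev E₂ (z 0) := mul_nonneg (mul_nonneg hy0 he₁) he₂
  have hB' : 0 ≤ 2 * z 1 * z 0 * ev E₁ (z 0) * ev E₂ (z 0) := by
    have := mul_nonneg (mul_nonneg (mul_nonneg hx0 hy0) he₁) he₂; nlinarith
  exact div_pos (by linarith) (by linarith)

/-- `mulChart_hasDerivAt`: auxiliary theorem of the log-fibre calculus for `RationalCubePiKernelSingle` (stmt-26322) — see the module docstring; verbatim from the lens-2 g6 file. -/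
theorem mulChart_hasDerivAt {z : Fin 2 → ℝ} (hz : z ∈ KZ.cube 2) :
    HasDerivAt (fun s : ℝ => (mulChart h₁ h₂ hsum).fn (Fin.snoc (Fin.init z) s))
      (mulDeriv E₁ E₂ z) (z 1) := by
  have hy := init_mem_cube_one hz
  have hfun : (fun s : ℝ => (mulChart h₁ h₂ hsum).fn (Fin.snoc (Fin.init z) s)) = fun s =>
      s * (ev E₁ (z 0) + ev E₂ (z 0) + s * (z 0 * ev E₁ (z 0) * ev E₂ (z 0))) /
        (ev E₁ (z 0) + ev E₂ (z 0) + z 0 * ev E₁ (z 0) * ev E₂ (z 0)) := by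
    funext s
    rw [mulChart_fn_snoc h₁ h₂ hsum hy s, init_apply_zero]
    ring
  rw [hfun]
  have hd := (((hasDerivAt_id' (z 1)).mul
    (((hasDerivAt_id' (z 1)).mul_const (z 0 * ev E₁ (z 0) * ev E₂ (z 0))).const_add
      (ev E₁ (z 0) + ev E₂ (z 0)))).div_const
    (ev E₁ (z 0) + ev E₂ (z 0) + z 0 * ev E₁ (z 0) * ev E₂ (z 0)))
  refine hd.congr_deriv ?_
  unfold mulDeriv
  ring

/-- **Product rule** `Λ[E] ≡ Λ[E₁] + Λ[E₂]` for `E = E₁ + E₂ + y E₁E₂` (i.e. `1 + yE = (1 + yE₁)(1 + yE₂)`),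
`E₁, E₂ ≥ 0`, `E₁ + E₂ > 0` on `[0,1]`: ONE fibred change of variables + integrand additivity. -/
theorem lam_mul (h₁ : ∀ t ∈ Icc (0 : ℝ) 1, 0 ≤ ev E₁ t) (h₂ : ∀ t ∈ Icc (0 : ℝ) 1, 0 ≤ ev E₂ t)
    (hsum : ∀ t ∈ Icc (0 : ℝ) 1, 0 < ev E₁ t + ev E₂ t) {E : RFun 1}
    (hE : ∀ t ∈ Icc (0 : ℝ) 1, 0 ≤ ev E t)
    (hprod : ∀ t ∈ Icc (0 : ℝ) 1, ev E t = ev E₁ t + ev E₂ t + t * ev E₁ t * ev E₂ t) :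
    KZ.of (lam E hE).rep - KZ.of (lam E₁ h₁).rep - KZ.of (lam E₂ h₂).rep ∈ KZ.relations := by
  have hadd := rel_add (lam E₁ h₁) (lam E₂ h₂)
  have hfib : KZ.of ((lam E₁ h₁).add (lam E₂ h₂)).rep - KZ.of (lam E hE).rep ∈ KZ.relations := by
    refine rel_fibreMap _ _ (mulChart h₁ h₂ hsum) (mulDeriv E₁ E₂)
      (fun z hz => mulChart_hasDerivAt h₁ h₂ hsum hz) (fun z hz => mulDeriv_pos h₁ h₂ hsum hz)
      (fun x hx => ?_) (fun x hx => ?_) (fun z hz => ?_)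
    · rw [mulChart_fn_snoc h₁ h₂ hsum hx]; simp
    · obtain ⟨-, -, he₁, he₂, hs, hy0, -⟩ := facts_one h₁ h₂ hsum hx
      rw [mulChart_fn_snoc h₁ h₂ hsum hx]
      simp only [one_mul]
      refine div_self (ne_of_gt ?_)
      have : 0 ≤ x 0 * ev E₁ (x 0) * ev E₂ (x 0) := mul_nonneg (mul_nonneg hy0 he₁) he₂
      linarith
    · obtain ⟨-, -, he₁, he₂, hs, hy0, -⟩ := facts_one h₁ h₂ hsum (init_mem_cube_one hz)
      simp only [init_apply_zero] at he₁ he₂ hs hy0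
      obtain ⟨-, hx0, -⟩ := mem_cube_two hz
      have hU := mulChart_mem h₁ h₂ hsum hz
      have hw : (Fin.snoc (Fin.init z) ((mulChart h₁ h₂ hsum).fn z) : Fin 2 → ℝ) ∈ KZ.cube 2 :=
        KZ.snoc_mem_cube_iff.2 ⟨init_mem_cube_one hz, hU.1, hU.2⟩
      rw [fn_add hz, fn_lam hz, fn_lam hz, fn_lam hw, snoc_two_zero, snoc_two_one, init_apply_zero,
        hprod _ (mem_cube_two hz).1, mulChart_fn h₁ h₂ hsum hz, mulDeriv]
      exact mul_identity he₁ he₂ hs hx0 hy0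
  have := sub_mem hadd hfib
  convert this using 1
  abel

end Mul

/-! ## 4. The power rule `Λ[E] ≡ (j+1) • Λ[y^j E(y^{j+1})]` -/

end Summit.KontsevichZagierPeriods.RootDecompRationalCubeDichotomy.LogFibre

end
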